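import Mathlib
import HarnessLib
import Summits.HubbardSuperconductivity.HubbardSuperconductivity.Theorems.KLProgrammeKLRegimeSplitBundleV12
import Summits.HubbardSuperconductivity.HubbardSuperconductivity.Theorems.KLProgrammeKLRegimeEnginePairWeightSymmetric

/-!
# Route `KLProgramme` — crux K3, ENGINE child `KLRegimeEngineV11` (stmt-HubbardSuperconductivity-19823) and its gen-4 successor on `klPredsV12`:
# the BY-NAME instance of the signed (E2) bridge on the gen-4 clause `PairLadderStepAtV8` (BundleV12, p470806)

Cell gate-hubbard-kl, seat hubbard-kl-k3c1-p1 (g3; technique «composed-map remainder propagation»; plan2's T₀ rule gate G5 «k3c1-p1's V8 bridge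
instance»); sequel to `…EnginePairLadderSigned` (p469901: `klpls_signedStepReal_of_expansion`, abstract allowance `E` and budget `B`) and
`…EnginePairWeightSymmetric` (p471286: the reality and mass inputs at the Matsubara-sum level).

§1 the MASS input against the gen-4 profile `E := 2·klEdge G n |Qm|_𝕋` in its two zones: deep inside the class (`klEdgeKappa·|Qm|_𝕋 < Λ_n`) every
aggregated slice pair weight is a nonnegative real (termwise positivity: p1 g7's `kled_pairWeight_re_nonneg_of_slice`, EdgeFacts p471405, or
`klpws_pairTerm_re_nonneg` + the deep-zone geometry) ⇒ signed mass `0 ≤ E` (`klEdge_nonneg`); in the edge zone `klEdge = G.bhi`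
(`klEdge_eq_bhi_of_le`) and the signed mass is `≤ 2·Σ‖z′‖ ≤ 2·G.bhi` with NO sign information — `klpws_massInput_klEdge` does the case split.
§2 **`pairLadderStepAtV8_of_expansion`**: `PairLadderStepAtV8 L M G P Q β U μ K n` at `1 ≤ n` from the history's split slot `PairArrayAtV2 … (n−1)`,
the smallness `bhi·(2|U| + D·U²) ≤ 1/3` (`klEng_pair_smallness`), and per pair class the engine's expansion data (rung array `K`, frequency-resolved
weights `z′` with `Σ‖z′‖ ≤ bhi`, the mass input, the reality input `Im Σ_b z′_(p,b) = 0` (`klpws_realInput` / `kled_matsubara_pairWeight_sum_im_eq_zero`),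
the `K`-ladder sum, ONE per-entry accounting `‖𝒞_n − T_K‖ + [four-term localisation] ≤` the V7 budget verbatim) — `w := Re Σ_b z′_(·,b)` (the TRUE
aggregated slice weights), `N := N_w` by Neumann; no transfer term, no sign fact about `B_n(Qm)`.  If the typing authority's (R3) profile
`2·G.bhi·negEdgeBar n ρ` (plan g11 STATUS 22:25:18Z) replaces `2·klEdge G n ρ` in the clause, only §1's three lemmas and the `E :=` token of §2 change.
§3 the UNIFORM corollary: `klpls_fourTerm_le_unif` (the four-term localisation expression is `≤ (5/4)·ε` when the rung perturbation is `≤ ε` on the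
weight support and vanishes at the external entry) and **`pairLadderStepAtV8_of_expansion_unif`** (the engine supplies ONE number `ε` — the
scale-`(n−1)` pair vertex's frequency variation over the slice-`n` support — and the accounting `‖𝒞_n − T_K‖ + (5/4)·ε ≤` budget);
§4 the same with the MINIMAL localisation hypothesis (`klpls_fourTerm_le_unif'`, `pairLadderStepAtV8_of_expansion_unif'`): rung entries are read only
between RELEVANT indices (weighted or external, at least one weighted) — no truncation of the rung array outside the ball is forced.
Everything is proved; no definitions; nothing about the model is asserted.  0 kit.
-/

noncomputable section

namespace Summit.HubbardSuperconductivity.HubbardSuperconductivity.Theorems.KLRegimeSplit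

set_option linter.dupNamespace false -- summit = problem name (single-conjunct summit), D-0017

open Finset Matrix Literature.MathematicalPhysics.QuantumLattice Literature.Probability.LatticeModels
open Summit.HubbardSuperconductivity.HubbardSuperconductivity.Theorems.KLProgrammeCooperResummation
open Summit.HubbardSuperconductivity.HubbardSuperconductivity.Theorems.KLProgrammeLegKernels

/-! ## §1 The mass input against the gen-4 profile `2·klEdge G n |Qm|_𝕋` in the two zones -/

section MassKlEdge

variable (L : ℕ)
variable {S F : Type*} [Fintype S] [Fintype F]

/-- **Deep zone**: every aggregated weight a nonnegative real ⇒ the signed mass is `0 ≤ 2·klEdge G n |Qm|_𝕋` (`0 ≤ G.bhi`). -/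
theorem klpws_massInput_klEdge_deep {G : GeoConsts} (hG : 0 ≤ G.bhi) (n : ℕ) (Qm : TorusSite 2 L) (z' : S × F → ℂ)
    (hpos : ∀ s, 0 ≤ (∑ b, z' (s, b)).re ∧ (∑ b, z' (s, b)).im = 0) :
    (∑ s, ‖∑ b, z' (s, b)‖) - (∑ s, ∑ b, z' (s, b)).re ≤ 2 * klEdge G n (klTorusNorm L Qm) :=
  klpws_massInput_deep z' (mul_nonneg zero_le_two (klEdge_nonneg hG n (torusSupNorm_nonneg _))) hpos

/-- **Edge zone** `Λ_n ≤ klEdgeKappa·|Qm|_𝕋`: no sign information needed — the signed mass is `≤ 2·Σ‖z′‖ ≤ 2·G.bhi = 2·klEdge G n |Qm|_𝕋`. -/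
theorem klpws_massInput_klEdge_edge {G : GeoConsts} (n : ℕ) (Qm : TorusSite 2 L) (z' : S × F → ℂ) (hzb : ∑ x, ‖z' x‖ ≤ G.bhi)
    (hedge : klScale klE0 n ≤ klEdgeKappa * klTorusNorm L Qm) :
    (∑ s, ‖∑ b, z' (s, b)‖) - (∑ s, ∑ b, z' (s, b)).re ≤ 2 * klEdge G n (klTorusNorm L Qm) := by
  rw [klEdge_eq_bhi_of_le G hedge]
  exact klpws_massInput_edge z' hzb le_rfl

/-- **Both zones at once**: total variation `≤ G.bhi` always, and nonnegative real aggregated weights whenever `klEdgeKappa·|Qm|_𝕋 < Λ_n`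
⇒ the signed mass is `≤ 2·klEdge G n |Qm|_𝕋`. -/
theorem klpws_massInput_klEdge {G : GeoConsts} (hG : 0 ≤ G.bhi) (n : ℕ) (Qm : TorusSite 2 L) (z' : S × F → ℂ) (hzb : ∑ x, ‖z' x‖ ≤ G.bhi)
    (hdeep : klEdgeKappa * klTorusNorm L Qm < klScale klE0 n → ∀ s, 0 ≤ (∑ b, z' (s, b)).re ∧ (∑ b, z' (s, b)).im = 0) :
    (∑ s, ‖∑ b, z' (s, b)‖) - (∑ s, ∑ b, z' (s, b)).re ≤ 2 * klEdge G n (klTorusNorm L Qm) := by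
  rcases lt_or_ge (klEdgeKappa * klTorusNorm L Qm) (klScale klE0 n) with h | h
  · exact klpws_massInput_klEdge_deep L hG n Qm z' (hdeep h)
  · exact klpws_massInput_klEdge_edge L n Qm z' hzb h

end MassKlEdge

/-! ## §2 The by-name instance: `PairLadderStepAtV8` at `1 ≤ n` from expansion-level data -/

section Model

variable (L M : ℕ) [NeZero L] [NeZero M]
variable {F : Type*} [Fintype F] [DecidableEq F] [Nonempty F]

/-- **(E2-v8) at `1 ≤ n` from expansion-level data, EXACT aggregated slice ladder, REAL signed weights.**  Fix the slice-frequency index type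
`F` and the external index `a₀ : F`.  From the history's split slot `PairArrayAtV2 … (n−1)`, the smallness `bhi·(2|U| + D·U²) ≤ 1/3`
(`klEng_pair_smallness`), and per pair class `Qm` the engine's rung array `K` (`|K| ≤ m′`, `m′·Σ‖z′‖ ≤ 1/3`), frequency-resolved weights `z′`
(`Σ‖z′‖ ≤ bhi`), the MASS input `(Σ_p ‖Σ_b z′_(p,b)‖) − Re Σ_p Σ_b z′_(p,b) ≤ 2·klEdge G n |Qm|_𝕋` (`klpws_massInput_klEdge`: termwise positivity deep
inside, nothing at the edge), the REALITY input `Im Σ_b z′_(p,b) = 0` (`klpws_realInput`: `ν ↦ −ν`), the `K`-ladder sum `T_K`, and ONE per-entry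
accounting `‖𝒞_n − T_K‖ + [four-term localisation] ≤` the V7 budget: `PairLadderStepAtV8 … n` with `w := Re Σ_b z′_(·,b)` and `N := N_w` —
no transfer term, no sign fact about `B_n(Qm)`. -/
theorem pairLadderStepAtV8_of_expansion {G : GeoConsts} {P : SplitConsts} {Q : EngConsts} {β U μ : ℝ} {K₀ : TrigPolyC4v} {n : ℕ}
    (a₀ : F) (hn : 1 ≤ n)
    (hsplit : PairArrayAtV2 L M P Q β U μ K₀ (n - 1)) (hD : 0 ≤ P.C_W + klLegKappa * Q.CR * P.Klam ^ 3)
    (hsmall : G.bhi * (2 * |U| + (P.C_W + klLegKappa * Q.CR * P.Klam ^ 3) * U ^ 2) ≤ 1 / 3)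
    (hexp : ∀ Qm : TorusSite 2 L, IsPairClassAt L Qm n →
      ∃ (K : Matrix (TorusSite 2 L × F) (TorusSite 2 L × F) ℂ) (z' : TorusSite 2 L × F → ℂ)
        (TK : Matrix (TorusSite 2 L × F) (TorusSite 2 L × F) ℂ) (m' : ℝ),
        0 ≤ m' ∧ (∀ x y, ‖K x y‖ ≤ m') ∧ m' * ∑ x, ‖z' x‖ ≤ 1 / 3 ∧ ∑ x, ‖z' x‖ ≤ G.bhi ∧
        (∑ p, ‖∑ b, z' (p, b)‖) - (∑ p, ∑ b, z' (p, b)).re ≤ 2 * klEdge G n (klTorusNorm L Qm) ∧ (∀ p, (∑ b, z' (p, b)).im = 0) ∧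
        HasSum (fun j : ℕ => K * (-(Matrix.diagonal z' * K)) ^ j) TK ∧
        ∀ k ∈ klBall L μ K₀, ∀ k' ∈ klBall L μ K₀,
          ‖klPairAmplitude L M β U μ K₀ n Qm k k' - TK (k, a₀) (k', a₀)‖ +
            (‖K (k, a₀) (k', a₀) - klPairArray L M β U μ K₀ (n - 1) Qm k k'‖ +
              3 / 2 * (2 * |U| + (P.C_W + klLegKappa * Q.CR * P.Klam ^ 3) * U ^ 2) *
                ∑ b, ‖K (k, a₀) b - klPairArray L M β U μ K₀ (n - 1) Qm k b.1‖ * ‖z' b‖ +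
              3 / 2 * m' * ∑ a, ‖z' a‖ * ‖K a (k', a₀) - klPairArray L M β U μ K₀ (n - 1) Qm a.1 k'‖ +
              9 / 4 * m' * (2 * |U| + (P.C_W + klLegKappa * Q.CR * P.Klam ^ 3) * U ^ 2) *
                ∑ a, ∑ b, ‖z' a‖ * ‖K a b - klPairArray L M β U μ K₀ (n - 1) Qm a.1 b.1‖ * ‖z' b‖) ≤
          drivePBar G P U (n - 1) + eremBar G P Q U β L (n - 1) + thermalBar G P U β n +
            legDressBarQ G P Q U n (legSliceCountT L β μ K₀ n ![k', Qm - k', Qm - k, k])) :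
    PairLadderStepAtV8 L M G P Q β U μ K₀ n := by
  have hm : 0 ≤ 2 * |U| + (P.C_W + klLegKappa * Q.CR * P.Klam ^ 3) * U ^ 2 := by
    have : 0 ≤ (P.C_W + klLegKappa * Q.CR * P.Klam ^ 3) * U ^ 2 := mul_nonneg hD (sq_nonneg U)
    have : 0 ≤ |U| := abs_nonneg U
    linarith
  refine ⟨fun h0 => absurd h0 (by omega), fun _ Qm hQm => ?_⟩
  obtain ⟨w, hb, hE, -, N, hN1, -, hbd⟩ := klpls_signedStepReal_of_expansion L M a₀ (fun Qm => 2 * klEdge G n (klTorusNorm L Qm))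
    (fun Qm k k' => drivePBar G P U (n - 1) + eremBar G P Q U β L (n - 1) + thermalBar G P U β n +
      legDressBarQ G P Q U n (legSliceCountT L β μ K₀ n ![k', Qm - k', Qm - k, k]))
    hm (fun Qm s t => klpli_pairArray_entry_le L M hsplit hD Qm s t) hsmall hexp Qm hQm
  exact ⟨w, hb, hE, N, hN1, hbd⟩

end Model

/-! ## §3 The UNIFORM corollary: the four-term localisation expression against ONE engine number `ε` -/

section Unif

variable {S F : Type*} [Fintype S] [Fintype F]

/-- **Four-term collapse.**  On the product carrier `S × F`: if the rung perturbation `E(a,b) = K(a,b) − C(a.1,b.1)` is `≤ ε` wherever a weight is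
present (`z′_a ≠ 0 ∨ z′_b ≠ 0`), VANISHES at the external entry `(x,y)`, and the weights are small (`m·Σ‖z′‖ ≤ 1/3`, `m′·Σ‖z′‖ ≤ 1/3`), then the
four-term localisation expression of `klell_localised_ladder` at `(x,y)` is `≤ (5/4)·ε` (`= ε/2 + ε/2 + ε/4`). -/
theorem klpls_fourTerm_le_unif (C : Matrix S S ℂ) (K : Matrix (S × F) (S × F) ℂ) (z' : S × F → ℂ) {m m' ε : ℝ}
    (hm : 0 ≤ m) (hm' : 0 ≤ m') (hε : 0 ≤ ε) (hzC : m * ∑ x, ‖z' x‖ ≤ 1 / 3) (hzK : m' * ∑ x, ‖z' x‖ ≤ 1 / 3)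
    (hloc : ∀ a b, z' a ≠ 0 ∨ z' b ≠ 0 → ‖K a b - C a.1 b.1‖ ≤ ε) (x y : S × F) (hext : K x y = C x.1 y.1) :
    ‖K x y - C x.1 y.1‖ + 3 / 2 * m * ∑ b, ‖K x b - C x.1 b.1‖ * ‖z' b‖ + 3 / 2 * m' * ∑ a, ‖z' a‖ * ‖K a y - C a.1 y.1‖ +
        9 / 4 * m' * m * ∑ a, ∑ b, ‖z' a‖ * ‖K a b - C a.1 b.1‖ * ‖z' b‖ ≤ 5 / 4 * ε := by
  set Z : ℝ := ∑ x, ‖z' x‖ with hZ_def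
  have hZ : 0 ≤ Z := sum_nonneg fun x _ => norm_nonneg _
  have hb : ∀ a b, ‖K a b - C a.1 b.1‖ * ‖z' b‖ ≤ ε * ‖z' b‖ := by
    intro a b
    by_cases hzb : z' b = 0
    · simp [hzb]
    · exact mul_le_mul_of_nonneg_right (hloc a b (Or.inr hzb)) (norm_nonneg _)
  have ha : ∀ a b, ‖z' a‖ * ‖K a b - C a.1 b.1‖ ≤ ‖z' a‖ * ε := by
    intro a b
    by_cases hza : z' a = 0
    · simp [hza]
    · exact mul_le_mul_of_nonneg_left (hloc a b (Or.inl hza)) (norm_nonneg _)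
  have h1 : ‖K x y - C x.1 y.1‖ = 0 := by rw [hext, sub_self, norm_zero]
  have h2 : ∑ b, ‖K x b - C x.1 b.1‖ * ‖z' b‖ ≤ ε * Z := by
    rw [hZ_def, mul_sum]
    exact sum_le_sum fun b _ => hb x b
  have h3 : ∑ a, ‖z' a‖ * ‖K a y - C a.1 y.1‖ ≤ ε * Z := by
    rw [hZ_def, mul_sum]
    exact sum_le_sum fun a _ => (ha a y).trans (le_of_eq (mul_comm _ _))
  have h4' : ∑ a, ∑ b, ‖z' a‖ * ‖K a b - C a.1 b.1‖ * ‖z' b‖ ≤ ε * Z * Z :=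
    calc ∑ a, ∑ b, ‖z' a‖ * ‖K a b - C a.1 b.1‖ * ‖z' b‖ ≤ ∑ a, ∑ b, ‖z' a‖ * ε * ‖z' b‖ :=
          sum_le_sum fun a _ => sum_le_sum fun b _ => mul_le_mul_of_nonneg_right (ha a b) (norm_nonneg _)
      _ = (∑ a, ‖z' a‖ * ε) * ∑ b, ‖z' b‖ := by rw [Finset.sum_mul_sum]
      _ = ε * Z * Z := by rw [hZ_def, ← sum_mul]; ring
  have t2 : 3 / 2 * m * ∑ b, ‖K x b - C x.1 b.1‖ * ‖z' b‖ ≤ 3 / 2 * m * (ε * Z) :=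
    mul_le_mul_of_nonneg_left h2 (by positivity)
  have t3 : 3 / 2 * m' * ∑ a, ‖z' a‖ * ‖K a y - C a.1 y.1‖ ≤ 3 / 2 * m' * (ε * Z) :=
    mul_le_mul_of_nonneg_left h3 (by positivity)
  have t4 : 9 / 4 * m' * m * ∑ a, ∑ b, ‖z' a‖ * ‖K a b - C a.1 b.1‖ * ‖z' b‖ ≤ 9 / 4 * m' * m * (ε * Z * Z) :=
    mul_le_mul_of_nonneg_left h4' (by positivity)
  have hA : 0 ≤ m * Z := mul_nonneg hm hZ
  have hAB : (m' * Z) * (m * Z) ≤ 1 / 9 :=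
    calc (m' * Z) * (m * Z) ≤ 1 / 3 * (m * Z) := mul_le_mul_of_nonneg_right hzK hA
      _ ≤ 1 / 3 * (1 / 3) := mul_le_mul_of_nonneg_left hzC (by norm_num)
      _ = 1 / 9 := by norm_num
  have e1 : ε * (m * Z) ≤ ε * (1 / 3) := mul_le_mul_of_nonneg_left hzC hε
  have e2 : ε * (m' * Z) ≤ ε * (1 / 3) := mul_le_mul_of_nonneg_left hzK hε
  have e3 : ε * ((m' * Z) * (m * Z)) ≤ ε * (1 / 9) := mul_le_mul_of_nonneg_left hAB hε
  have key : 3 / 2 * m * (ε * Z) + 3 / 2 * m' * (ε * Z) + 9 / 4 * m' * m * (ε * Z * Z) =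
      3 / 2 * (ε * (m * Z)) + 3 / 2 * (ε * (m' * Z)) + 9 / 4 * (ε * ((m' * Z) * (m * Z))) := by ring
  rw [h1, zero_add]
  linarith

end Unif

section ModelUnif

variable (L M : ℕ) [NeZero L] [NeZero M]
variable {F : Type*} [Fintype F] [DecidableEq F] [Nonempty F]

/-- **(E2-v8) at `1 ≤ n`, UNIFORM localisation form.**  As `pairLadderStepAtV8_of_expansion`, but the engine supplies ONE number `ε ≥ 0` per pair
class instead of the four-term expression: the scale-`(n−1)` pair vertex's FREQUENCY VARIATION over the slice-`n` weight support,
`‖K(a,b) − 𝒞_{n−1}(Qm)(a.1,b.1)‖ ≤ ε` whenever `z′_a ≠ 0 ∨ z′_b ≠ 0`, together with `K((k,a₀),(k′,a₀)) = 𝒞_{n−1}(Qm)(k,k′)` at the external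
frequency index on the ball; the accounting is then `‖𝒞_n(Qm;k,k′) − T_K((k,a₀),(k′,a₀))‖ + (5/4)·ε ≤` the V7 budget.  (Sizing, not proved here:
`ε` is second order in the running couplings — the bare `U` is frequency-flat — so the localisation share of the per-scale remainder is `O(U³)`.) -/
theorem pairLadderStepAtV8_of_expansion_unif {G : GeoConsts} {P : SplitConsts} {Q : EngConsts} {β U μ : ℝ} {K₀ : TrigPolyC4v} {n : ℕ}
    (a₀ : F) (hn : 1 ≤ n)
    (hsplit : PairArrayAtV2 L M P Q β U μ K₀ (n - 1)) (hD : 0 ≤ P.C_W + klLegKappa * Q.CR * P.Klam ^ 3)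
    (hsmall : G.bhi * (2 * |U| + (P.C_W + klLegKappa * Q.CR * P.Klam ^ 3) * U ^ 2) ≤ 1 / 3)
    (hexp : ∀ Qm : TorusSite 2 L, IsPairClassAt L Qm n →
      ∃ (K : Matrix (TorusSite 2 L × F) (TorusSite 2 L × F) ℂ) (z' : TorusSite 2 L × F → ℂ)
        (TK : Matrix (TorusSite 2 L × F) (TorusSite 2 L × F) ℂ) (m' ε : ℝ),
        0 ≤ m' ∧ (∀ x y, ‖K x y‖ ≤ m') ∧ m' * ∑ x, ‖z' x‖ ≤ 1 / 3 ∧ ∑ x, ‖z' x‖ ≤ G.bhi ∧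
        (∑ p, ‖∑ b, z' (p, b)‖) - (∑ p, ∑ b, z' (p, b)).re ≤ 2 * klEdge G n (klTorusNorm L Qm) ∧ (∀ p, (∑ b, z' (p, b)).im = 0) ∧
        HasSum (fun j : ℕ => K * (-(Matrix.diagonal z' * K)) ^ j) TK ∧
        0 ≤ ε ∧ (∀ a b, z' a ≠ 0 ∨ z' b ≠ 0 → ‖K a b - klPairArray L M β U μ K₀ (n - 1) Qm a.1 b.1‖ ≤ ε) ∧
        (∀ k ∈ klBall L μ K₀, ∀ k' ∈ klBall L μ K₀, K (k, a₀) (k', a₀) = klPairArray L M β U μ K₀ (n - 1) Qm k k') ∧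
        ∀ k ∈ klBall L μ K₀, ∀ k' ∈ klBall L μ K₀,
          ‖klPairAmplitude L M β U μ K₀ n Qm k k' - TK (k, a₀) (k', a₀)‖ + 5 / 4 * ε ≤
            drivePBar G P U (n - 1) + eremBar G P Q U β L (n - 1) + thermalBar G P U β n +
              legDressBarQ G P Q U n (legSliceCountT L β μ K₀ n ![k', Qm - k', Qm - k, k])) :
    PairLadderStepAtV8 L M G P Q β U μ K₀ n := by
  have hm : 0 ≤ 2 * |U| + (P.C_W + klLegKappa * Q.CR * P.Klam ^ 3) * U ^ 2 := by
    have : 0 ≤ (P.C_W + klLegKappa * Q.CR * P.Klam ^ 3) * U ^ 2 := mul_nonneg hD (sq_nonneg U)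
    have : 0 ≤ |U| := abs_nonneg U
    linarith
  refine pairLadderStepAtV8_of_expansion L M a₀ hn hsplit hD hsmall fun Qm hQm => ?_
  obtain ⟨K, z', TK, m', ε, hm', hK, hzK, hzsum, hmass, hreal, hTK, hε, hloc, hext, hacc⟩ := hexp Qm hQm
  refine ⟨K, z', TK, m', hm', hK, hzK, hzsum, hmass, hreal, hTK, fun k hk k' hk' => ?_⟩
  have hzC : (2 * |U| + (P.C_W + klLegKappa * Q.CR * P.Klam ^ 3) * U ^ 2) * ∑ x, ‖z' x‖ ≤ 1 / 3 :=
    calc (2 * |U| + (P.C_W + klLegKappa * Q.CR * P.Klam ^ 3) * U ^ 2) * ∑ x, ‖z' x‖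
        ≤ (2 * |U| + (P.C_W + klLegKappa * Q.CR * P.Klam ^ 3) * U ^ 2) * G.bhi := mul_le_mul_of_nonneg_left hzsum hm
      _ = G.bhi * (2 * |U| + (P.C_W + klLegKappa * Q.CR * P.Klam ^ 3) * U ^ 2) := mul_comm _ _
      _ ≤ 1 / 3 := hsmall
  have h4 := klpls_fourTerm_le_unif (klPairArray L M β U μ K₀ (n - 1) Qm) K z' hm hm' hε hzC hzK hloc (k, a₀) (k', a₀)
    (hext k hk k' hk')
  have h1 := hacc k hk k' hk'
  linarith

end ModelUnif

/-! ## §4 The uniform corollary with the MINIMAL localisation hypothesis (rung entries between RELEVANT indices only) -/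

section UnifMin

variable {S F : Type*} [Fintype S] [Fintype F]

/-- **Four-term collapse, minimal hypothesis.**  As `klpls_fourTerm_le_unif`, but the rung perturbation `E(a,b) = K(a,b) − C(a.1,b.1)` is asked to be
`≤ ε` only between RELEVANT indices — `a`, `b` each weighted (`z′ ≠ 0`) or external (`X`), and at least one of them weighted — which is all the
four-term expression at an external entry `(x,y)` (`X x`, `X y`) ever reads; entries of `K` at unweighted non-external indices are free (no truncation
of the rung array is forced). -/
theorem klpls_fourTerm_le_unif' (C : Matrix S S ℂ) (K : Matrix (S × F) (S × F) ℂ) (z' : S × F → ℂ) (X : S × F → Prop) {m m' ε : ℝ}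
    (hm : 0 ≤ m) (hm' : 0 ≤ m') (hε : 0 ≤ ε) (hzC : m * ∑ x, ‖z' x‖ ≤ 1 / 3) (hzK : m' * ∑ x, ‖z' x‖ ≤ 1 / 3)
    (hloc : ∀ a b, (z' a ≠ 0 ∨ X a) → (z' b ≠ 0 ∨ X b) → (z' a ≠ 0 ∨ z' b ≠ 0) → ‖K a b - C a.1 b.1‖ ≤ ε)
    (x y : S × F) (hx : X x) (hy : X y) (hext : K x y = C x.1 y.1) :
    ‖K x y - C x.1 y.1‖ + 3 / 2 * m * ∑ b, ‖K x b - C x.1 b.1‖ * ‖z' b‖ + 3 / 2 * m' * ∑ a, ‖z' a‖ * ‖K a y - C a.1 y.1‖ +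
        9 / 4 * m' * m * ∑ a, ∑ b, ‖z' a‖ * ‖K a b - C a.1 b.1‖ * ‖z' b‖ ≤ 5 / 4 * ε := by
  set Z : ℝ := ∑ x, ‖z' x‖ with hZ_def
  have hZ : 0 ≤ Z := sum_nonneg fun x _ => norm_nonneg _
  -- the three weighted patterns: (x, b) with z′_b ≠ 0; (a, y) with z′_a ≠ 0; (a, b) with both ≠ 0
  have hb : ∀ b, ‖K x b - C x.1 b.1‖ * ‖z' b‖ ≤ ε * ‖z' b‖ := by
    intro b
    by_cases hzb : z' b = 0
    · simp [hzb]
    · exact mul_le_mul_of_nonneg_right (hloc x b (Or.inr hx) (Or.inl hzb) (Or.inr hzb)) (norm_nonneg _)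
  have ha : ∀ a, ‖z' a‖ * ‖K a y - C a.1 y.1‖ ≤ ‖z' a‖ * ε := by
    intro a
    by_cases hza : z' a = 0
    · simp [hza]
    · exact mul_le_mul_of_nonneg_left (hloc a y (Or.inl hza) (Or.inr hy) (Or.inl hza)) (norm_nonneg _)
  have hab : ∀ a b, ‖z' a‖ * ‖K a b - C a.1 b.1‖ * ‖z' b‖ ≤ ‖z' a‖ * ε * ‖z' b‖ := by
    intro a b
    by_cases hza : z' a = 0
    · simp [hza]
    by_cases hzb : z' b = 0
    · simp [hzb]
    exact mul_le_mul_of_nonneg_right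
      (mul_le_mul_of_nonneg_left (hloc a b (Or.inl hza) (Or.inl hzb) (Or.inl hza)) (norm_nonneg _)) (norm_nonneg _)
  have h1 : ‖K x y - C x.1 y.1‖ = 0 := by rw [hext, sub_self, norm_zero]
  have h2 : ∑ b, ‖K x b - C x.1 b.1‖ * ‖z' b‖ ≤ ε * Z := by
    rw [hZ_def, mul_sum]
    exact sum_le_sum fun b _ => hb b
  have h3 : ∑ a, ‖z' a‖ * ‖K a y - C a.1 y.1‖ ≤ ε * Z := by
    rw [hZ_def, mul_sum]
    exact sum_le_sum fun a _ => (ha a).trans (le_of_eq (mul_comm _ _))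
  have h4' : ∑ a, ∑ b, ‖z' a‖ * ‖K a b - C a.1 b.1‖ * ‖z' b‖ ≤ ε * Z * Z :=
    calc ∑ a, ∑ b, ‖z' a‖ * ‖K a b - C a.1 b.1‖ * ‖z' b‖ ≤ ∑ a, ∑ b, ‖z' a‖ * ε * ‖z' b‖ :=
          sum_le_sum fun a _ => sum_le_sum fun b _ => hab a b
      _ = (∑ a, ‖z' a‖ * ε) * ∑ b, ‖z' b‖ := by rw [Finset.sum_mul_sum]
      _ = ε * Z * Z := by rw [hZ_def, ← sum_mul]; ring
  have t2 : 3 / 2 * m * ∑ b, ‖K x b - C x.1 b.1‖ * ‖z' b‖ ≤ 3 / 2 * m * (ε * Z) :=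
    mul_le_mul_of_nonneg_left h2 (by positivity)
  have t3 : 3 / 2 * m' * ∑ a, ‖z' a‖ * ‖K a y - C a.1 y.1‖ ≤ 3 / 2 * m' * (ε * Z) :=
    mul_le_mul_of_nonneg_left h3 (by positivity)
  have t4 : 9 / 4 * m' * m * ∑ a, ∑ b, ‖z' a‖ * ‖K a b - C a.1 b.1‖ * ‖z' b‖ ≤ 9 / 4 * m' * m * (ε * Z * Z) :=
    mul_le_mul_of_nonneg_left h4' (by positivity)
  have hA : 0 ≤ m * Z := mul_nonneg hm hZ
  have hAB : (m' * Z) * (m * Z) ≤ 1 / 9 :=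
    calc (m' * Z) * (m * Z) ≤ 1 / 3 * (m * Z) := mul_le_mul_of_nonneg_right hzK hA
      _ ≤ 1 / 3 * (1 / 3) := mul_le_mul_of_nonneg_left hzC (by norm_num)
      _ = 1 / 9 := by norm_num
  have e1 : ε * (m * Z) ≤ ε * (1 / 3) := mul_le_mul_of_nonneg_left hzC hε
  have e2 : ε * (m' * Z) ≤ ε * (1 / 3) := mul_le_mul_of_nonneg_left hzK hε
  have e3 : ε * ((m' * Z) * (m * Z)) ≤ ε * (1 / 9) := mul_le_mul_of_nonneg_left hAB hε
  have key : 3 / 2 * m * (ε * Z) + 3 / 2 * m' * (ε * Z) + 9 / 4 * m' * m * (ε * Z * Z) =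
      3 / 2 * (ε * (m * Z)) + 3 / 2 * (ε * (m' * Z)) + 9 / 4 * (ε * ((m' * Z) * (m * Z))) := by ring
  rw [h1, zero_add]
  linarith

end UnifMin

section ModelUnifMin

variable (L M : ℕ) [NeZero L] [NeZero M]
variable {F : Type*} [Fintype F] [DecidableEq F] [Nonempty F]

/-- **(E2-v8) at `1 ≤ n`, uniform localisation form, MINIMAL hypothesis** — as `pairLadderStepAtV8_of_expansion_unif`, but the rung's frequency
variation `‖K(a,b) − 𝒞_{n−1}(Qm)(a.1,b.1)‖ ≤ ε` is asked only between RELEVANT indices: `a`, `b` each in the slice-weight support or EXTERNAL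
(`(k, a₀)` with `k` in the ball), and at least one of them weighted.  No truncation of the rung array outside the ball is forced. -/
theorem pairLadderStepAtV8_of_expansion_unif' {G : GeoConsts} {P : SplitConsts} {Q : EngConsts} {β U μ : ℝ} {K₀ : TrigPolyC4v} {n : ℕ}
    (a₀ : F) (hn : 1 ≤ n)
    (hsplit : PairArrayAtV2 L M P Q β U μ K₀ (n - 1)) (hD : 0 ≤ P.C_W + klLegKappa * Q.CR * P.Klam ^ 3)
    (hsmall : G.bhi * (2 * |U| + (P.C_W + klLegKappa * Q.CR * P.Klam ^ 3) * U ^ 2) ≤ 1 / 3)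
    (hexp : ∀ Qm : TorusSite 2 L, IsPairClassAt L Qm n →
      ∃ (K : Matrix (TorusSite 2 L × F) (TorusSite 2 L × F) ℂ) (z' : TorusSite 2 L × F → ℂ)
        (TK : Matrix (TorusSite 2 L × F) (TorusSite 2 L × F) ℂ) (m' ε : ℝ),
        0 ≤ m' ∧ (∀ x y, ‖K x y‖ ≤ m') ∧ m' * ∑ x, ‖z' x‖ ≤ 1 / 3 ∧ ∑ x, ‖z' x‖ ≤ G.bhi ∧
        (∑ p, ‖∑ b, z' (p, b)‖) - (∑ p, ∑ b, z' (p, b)).re ≤ 2 * klEdge G n (klTorusNorm L Qm) ∧ (∀ p, (∑ b, z' (p, b)).im = 0) ∧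
        HasSum (fun j : ℕ => K * (-(Matrix.diagonal z' * K)) ^ j) TK ∧
        0 ≤ ε ∧
        (∀ a b : TorusSite 2 L × F, (z' a ≠ 0 ∨ (a.1 ∈ klBall L μ K₀ ∧ a.2 = a₀)) → (z' b ≠ 0 ∨ (b.1 ∈ klBall L μ K₀ ∧ b.2 = a₀)) →
          (z' a ≠ 0 ∨ z' b ≠ 0) → ‖K a b - klPairArray L M β U μ K₀ (n - 1) Qm a.1 b.1‖ ≤ ε) ∧
        (∀ k ∈ klBall L μ K₀, ∀ k' ∈ klBall L μ K₀, K (k, a₀) (k', a₀) = klPairArray L M β U μ K₀ (n - 1) Qm k k') ∧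
        ∀ k ∈ klBall L μ K₀, ∀ k' ∈ klBall L μ K₀,
          ‖klPairAmplitude L M β U μ K₀ n Qm k k' - TK (k, a₀) (k', a₀)‖ + 5 / 4 * ε ≤
            drivePBar G P U (n - 1) + eremBar G P Q U β L (n - 1) + thermalBar G P U β n +
              legDressBarQ G P Q U n (legSliceCountT L β μ K₀ n ![k', Qm - k', Qm - k, k])) :
    PairLadderStepAtV8 L M G P Q β U μ K₀ n := by
  have hm : 0 ≤ 2 * |U| + (P.C_W + klLegKappa * Q.CR * P.Klam ^ 3) * U ^ 2 := by
    have : 0 ≤ (P.C_W + klLegKappa * Q.CR * P.Klam ^ 3) * U ^ 2 := mul_nonneg hD (sq_nonneg U)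
    have : 0 ≤ |U| := abs_nonneg U
    linarith
  refine pairLadderStepAtV8_of_expansion L M a₀ hn hsplit hD hsmall fun Qm hQm => ?_
  obtain ⟨K, z', TK, m', ε, hm', hK, hzK, hzsum, hmass, hreal, hTK, hε, hloc, hext, hacc⟩ := hexp Qm hQm
  refine ⟨K, z', TK, m', hm', hK, hzK, hzsum, hmass, hreal, hTK, fun k hk k' hk' => ?_⟩
  have hzC : (2 * |U| + (P.C_W + klLegKappa * Q.CR * P.Klam ^ 3) * U ^ 2) * ∑ x, ‖z' x‖ ≤ 1 / 3 :=
    calc (2 * |U| + (P.C_W + klLegKappa * Q.CR * P.Klam ^ 3) * U ^ 2) * ∑ x, ‖z' x‖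
        ≤ (2 * |U| + (P.C_W + klLegKappa * Q.CR * P.Klam ^ 3) * U ^ 2) * G.bhi := mul_le_mul_of_nonneg_left hzsum hm
      _ = G.bhi * (2 * |U| + (P.C_W + klLegKappa * Q.CR * P.Klam ^ 3) * U ^ 2) := mul_comm _ _
      _ ≤ 1 / 3 := hsmall
  have h4 := klpls_fourTerm_le_unif' (klPairArray L M β U μ K₀ (n - 1) Qm) K z'
    (fun a => a.1 ∈ klBall L μ K₀ ∧ a.2 = a₀) hm hm' hε hzC hzK hloc (k, a₀) (k', a₀) ⟨hk, rfl⟩ ⟨hk', rfl⟩ (hext k hk k' hk')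
  have h1 := hacc k hk k' hk'
  linarith

end ModelUnifMin

end Summit.HubbardSuperconductivity.HubbardSuperconductivity.Theorems.KLRegimeSplit

end
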